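import Literature.Analysis.FluidPDE.ChaeTypeIIProfileSteadyLimit
import Literature.Analysis.FluidPDE.SobolevWeakGradient
import HarnessLib

/-!
# Chae 2010, Thm. 1.4 at the endpoint `p = 3`: the Gagliardo–Nirenberg–Sobolev inequality for
# weak gradients under `L^q` decay, and the very weak steady Liouville theorem on `2 ≤ p ≤ 9/2`

Analysis/FluidPDE proof file (no definitions, no named facts), the successor of
`ChaeTypeIIProfileSteadyLimit.lean` (the Type-II profile `V̄` of Chae's Theorem 1.4 is a very weak
STEADY Navier–Stokes solution, `typeII_profile_veryWeak_steadyNS`, `2 ≤ p`; and the theorem in the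
range `3 < p ≤ 9/2`, `chae2010_typeII_asymptoticallySelfSimilar_of_le_nineHalves`) and of
`SteadyNSVeryWeakLpLiouville.lean` (very weak steady `L^p` solutions, `3 < p`, are smooth — Kato's
representative, `exists_steadyClassicalNS_ae_eq_of_veryWeak` — and trivial in `Ḣ¹` for
`3 < p ≤ 9/2`, `veryWeak_steadyNS_ae_eq_zero_of_weakGradL2Sq_lt_top`).

The strict inequality `3 < p` of those files came ONLY from the regularity step (Kato's mild
theory, `p > 3`); the Liouville step itself (`steadyNS_eq_zero_of_memLp_of_dirichlet`, Galdi's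
`L^{9/2}` criterion via `Ḣ¹ ∩ L^q ⊂ L^{9/2}`) holds for `2 ≤ q ≤ 9/2`. Here the endpoint `p = 3`
(Chae's smallest exponent, `p ∈ [3, ∞)`) — and, for free, the whole very-weak range `2 ≤ p ≤ 3` —
is closed by lifting the integrability of the profile BEFORE the regularity step:
`V ∈ L^p ∩ Ḣ¹(ℝ³)`, `2 ≤ p < 6`, lies in `L⁶` by the Gagliardo–Nirenberg–Sobolev inequality for
WEAK gradients under `L^q` decay (the tree had it for `C¹` fields,
`eLpNorm_le_eLpNorm_fderiv_of_eq_of_eLpNorm_lt_top'` of `SteadyNSLiouvilleLpDirichlet.lean`, and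
for weak gradients only under `u ∈ L^p` at the GRADIENT exponent,
`eLpNorm_le_eLpNorm_weakFDeriv_of_eq` of `SobolevWeakGradient.lean`), hence in `L⁴` by Lebesgue
interpolation, and the `p = 4` road of the two predecessor files applies.

## Main statements

* `eLpNorm_le_eLpNorm_weakFDeriv_of_eq'` — **GNS for weak derivatives without `u ∈ L^p`**: on a
  real inner product space `E` of dimension `n ≥ 1`, for `1 ≤ p ≤ q`, `p'⁻¹ = p⁻¹ − n⁻¹`,
  `n(1/p − 1/q) < 1` (i.e. `q < p'`), every `u : E → F` with a weak derivative `G` on the whole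
  space (`Literature.Analysis.FunctionSpaces.HasWeakFDerivOn ⊤ volume u G`) and `‖u‖_{L^q} < ∞`
  satisfies `‖u‖_{L^{p'}} ≤ K ‖G‖_{L^p}`, `K = SNormLESNormFDerivOfEqConst F volume p` (Evans,
  *PDE*, §5.6.1, Thm. 1–2: mollify, apply the `C¹` inequality, Young's inequality, Fatou).
* `eLpNorm_six_le_lintegral_frobeniusNormSq_weakGradient'`,
  `memLp_six_of_memLp_of_eWeakGradL2Sq_lt_top` — the case `n = 3`, `p = 2`, `p' = 6`,
  `2 ≤ q < 6`: `Ḣ¹ ∩ L^q(ℝ³) ⊂ L⁶(ℝ³)` for weak gradients, with the Frobenius density of the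
  tree's dissipation functional `eWeakGradL2Sq`.
* `memLp_of_memLp_of_memLp_of_le` — Lebesgue interpolation `L^a ∩ L^b ⊂ L^r`, `a ≤ r ≤ b`
  (Robinson–Rodrigo–Sadowski 2016, Thm. 1.5; the tree's `lintegral_rpow_interpolate`).
* `veryWeak_steadyNS_ae_eq_zero_of_two_le_of_le_nineHalves` — **very weak steady Navier–Stokes
  solutions in `L^p ∩ Ḣ¹(ℝ³)`, `2 ≤ p ≤ 9/2`, vanish**: the statement of
  `veryWeak_steadyNS_ae_eq_zero_of_weakGradL2Sq_lt_top` with its binder `3 < p` replaced by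
  `2 ≤ p` and nothing else.
* `chae2010_typeII_asymptoticallySelfSimilar_of_le_nineHalves'` — **Chae 2010, Thm. 1.4 on
  `3 ≤ p ≤ 9/2` — a theorem**: the statement of the named fact
  `chae2010_typeII_asymptoticallySelfSimilar` (`ChaeGeneralizedSelfSimilar.lean`) with EXACTLY ONE
  extra binder `(p : ℝ≥0∞) ≤ 9/2`. The named fact itself (all `p ≥ 3`) is NOT discharged: for
  `p > 9/2` the printed last step ("`V̄ ∈ Ḣ¹ ∩ L^p` … `∫|∇V̄|² = 0`") is the open Liouville
  problem for steady `D`-solutions (`SteadyDSolutionLiouvilleProblem`, `SteadyNSLiouville.lean`).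
* `typeII_profile_ae_eq_zero_of_two_le_of_le_nineHalves` — the same conclusion for every
  `L^p` profile with `2 ≤ p ≤ 9/2` (Kato-class continuity of `v` is not used).

WHAT THIS IS NOT: not a statement about Navier–Stokes regularity or blow-up — a-priori kernel
statements about a HYPOTHETICAL Type-II asymptotically self-similar blow-up profile and about very
weak steady `L^p` solutions on `ℝ³`; nothing asserts that such an object exists.

## Mathlib / tree search

`lean search`: Mathlib (this pin) has the compactly supported `C¹` inequality
`MeasureTheory.eLpNorm_le_eLpNorm_fderiv_of_eq` only; the tree has the `C¹` whole-space forms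
under `u ∈ L^p` (`SobolevWholeSpace`) and under `u ∈ L^q`, `q < p'`
(`SteadyNSLiouvilleLpDirichlet`), and the weak form under `u ∈ L^p` (`SobolevWeakGradient`); no
weak form under `L^q` decay (`eLpNorm_le_eLpNorm_weakFDeriv`, `eLpNorm_six_le_.*weak`,
`memLp_six_of`). No Mathlib `MemLp` interpolation between two exponents on an infinite measure
space (`CompareExp.lean`: `MemLp.mono_exponent` is the finite-measure monotonicity).

## References

* D. Chae, *On the generalized self-similar singularities for the Euler and the Navier–Stokes
  equations*, J. Funct. Anal. 258 (2010) 2865–2883 = arXiv:0711.1113, §3, Thm. 3.1 (= JFA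
  Thm. 1.4) and its proof, p. 8 of the held arXiv text: "we can deduce that `V̄` is a stationary
  solution of the Navier-Stokes equations … In the case `V̄ ∈ Ḣ¹ ∩ L^p(ℝ³)`, we easily [obtain]
  from (3.1a) that `∫|∇V̄|² dy = 0`, which implies `V̄ = 0`." [Chae2010]
* L. C. Evans, *Partial Differential Equations*, 2nd ed. (2010), §5.6.1, Thm. 1 (GNS for `C¹_c`)
  and Thm. 2 (extension by density/truncation), §5.3 and App. C.4 (mollification). [Evans2010]
* J. C. Robinson, J. L. Rodrigo, W. Sadowski, *The three-dimensional Navier–Stokes equations*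
  (CUP 2016), Thm. 1.5 (Lebesgue interpolation), Thm. 1.7 (i) (Sobolev embedding).
  [RobinsonRodrigoSadowski2016]
* G. P. Galdi, *Steady-State Problems*, 2nd ed. (2011), Thm. X.9.5 (`L^{9/2}` Liouville).
  [Galdi2011]
* T. Kato, Math. Z. 187 (1984), Thm. 1 (`L^p` mild solutions, `p > 3`). [Kato1984]
-/

noncomputable section

open _root_.MeasureTheory Set Function Filter Metric TopologicalSpace Module ContinuousLinearMap
open scoped NNReal ENNReal _root_.Topology RealInnerProductSpace Laplacian Convolution

namespace Literature.Analysis.FluidPDE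

/-! ### The Gagliardo–Nirenberg–Sobolev inequality for weak derivatives under `L^q` decay -/

section WeakGNS

variable {E : Type*} [NormedAddCommGroup E] [InnerProductSpace ℝ E] [FiniteDimensional ℝ E]
  [MeasurableSpace E] [BorelSpace E]
variable {F : Type*} [NormedAddCommGroup F] [NormedSpace ℝ F] [FiniteDimensional ℝ F]

/-- **Gagliardo–Nirenberg–Sobolev inequality for weak derivatives, without `u ∈ L^p`.** Let `E`
have dimension `n ≥ 1`, `1 ≤ p ≤ q`, `p'⁻¹ = p⁻¹ − n⁻¹` and `n (1/p − 1/q) < 1` (i.e. `q < p'`);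
let `u : E → F` have the weak derivative `G` on the whole space
(`Literature.Analysis.FunctionSpaces.HasWeakFDerivOn ⊤ volume u G`) and `‖u‖_{L^q} < ∞`. Then
`‖u‖_{L^{p'}} ≤ K ‖G‖_{L^p}` with `K = SNormLESNormFDerivOfEqConst F volume p`, the constant of the
`C¹_c` inequality (Evans, *PDE*, §5.6.1, Thm. 1 with the density argument of Thm. 2: the
mollifications `uₙ = φₙ ⋆ u` are `C¹` with `Duₙ = φₙ ⋆ G`, `‖uₙ‖_q ≤ ‖u‖_q < ∞` and `‖Duₙ‖_p ≤ ‖G‖_p`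
(Young), the tree's `C¹` inequality under `L^q` decay
`eLpNorm_le_eLpNorm_fderiv_of_eq_of_eLpNorm_lt_top'` gives `‖uₙ‖_{p'} ≤ K‖G‖_p`, and `uₙ → u` a.e.
with Fatou's lemma in `L^{p'}`). The integrability hypothesis only excludes the constants; if
`G ∉ L^p` the right-hand side is `∞`. [cite: Evans2010, §5.6.1 Thm. 1–2] -/
theorem eLpNorm_le_eLpNorm_weakFDeriv_of_eq' {u : E → F} {G : E → E →L[ℝ] F}
    (hw : FunctionSpaces.HasWeakFDerivOn (⊤ : Opens E) volume u G) {p p' : ℝ≥0} {q : ℝ≥0∞}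
    (hp : 1 ≤ p) (hpq : (p : ℝ≥0∞) ≤ q) (hn : 0 < finrank ℝ E)
    (hp' : (p' : ℝ)⁻¹ = (p : ℝ)⁻¹ - (finrank ℝ E : ℝ)⁻¹)
    (hq : (finrank ℝ E : ℝ) * (1 / (p : ℝ) - 1 / q.toReal) < 1)
    (huq : eLpNorm u q volume < ∞) :
    eLpNorm u p' volume ≤
      SNormLESNormFDerivOfEqConst F (volume : Measure E) p * eLpNorm G p volume := by
  set K : ℝ≥0 := SNormLESNormFDerivOfEqConst F (volume : Measure E) p with hK
  have hp1 : (1 : ℝ≥0∞) ≤ (p : ℝ≥0∞) := by exact_mod_cast hp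
  have hq1 : (1 : ℝ≥0∞) ≤ q := hp1.trans hpq
  -- local integrability and measurability of `u` and `G`
  have hu_loc : LocallyIntegrable u volume := locallyIntegrableOn_univ.1 (by
    simpa only [Opens.coe_top] using hw.locallyIntegrableOn)
  have hG_loc : LocallyIntegrable G volume := locallyIntegrableOn_univ.1 (by
    simpa only [Opens.coe_top] using hw.locallyIntegrableOn_deriv)
  have hu_meas : AEStronglyMeasurable u volume := hu_loc.aestronglyMeasurable
  have hG_meas : AEStronglyMeasurable G volume := hG_loc.aestronglyMeasurable
  -- the mollifications
  obtain ⟨φ, hφ0, hφ2⟩ := FunctionSpaces.exists_contDiffBump_seq (E := E)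
  have htest : ∀ n, FunctionSpaces.IsTestFunctionOn (⊤ : Opens E) ((φ n).normed volume) :=
    fun n => FunctionSpaces.isTestFunctionOn_normed (φ n)
  set un : ℕ → E → F := fun n => (φ n).normed volume ⋆[lsmul ℝ ℝ, volume] u with hun
  have h1 : ∀ n, ContDiff ℝ 1 (un n) := fun n => hw.contDiff_convolution (htest n)
  have hderiv : ∀ n, fderiv ℝ (un n) = (φ n).normed volume ⋆[lsmul ℝ ℝ, volume] G := fun n =>
    funext fun x => (hw.hasFDerivAt_convolution (htest n) x).fderiv
  have hun_q : ∀ n, eLpNorm (un n) q volume < ∞ := fun n =>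
    (FunctionSpaces.eLpNorm_normed_convolution_le (φ n) hu_meas hq1).trans_lt huq
  -- the `C¹` inequality under `L^q` decay for each mollification, and Young for the derivative
  have hGNS : ∀ n, eLpNorm (un n) p' volume ≤ K * eLpNorm G p volume := fun n => by
    refine (eLpNorm_le_eLpNorm_fderiv_of_eq_of_eLpNorm_lt_top' volume (h1 n) hp hpq hn hp' hq
      (hun_q n)).trans ?_
    rw [← hK, hderiv n]
    gcongr
    exact FunctionSpaces.eLpNorm_normed_convolution_le (φ n) hG_meas hp1
  -- a.e. convergence and Fatou
  have hlim : ∀ᵐ x ∂(volume : Measure E), Tendsto (fun n => un n x) atTop (𝓝 (u x)) :=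
    FunctionSpaces.ae_tendsto_normed_convolution hφ0 hφ2 hu_loc
  have hFatou : eLpNorm u p' volume ≤ atTop.liminf fun n => eLpNorm (un n) p' volume :=
    Lp.eLpNorm_lim_le_liminf_eLpNorm (fun n => (h1 n).continuous.aestronglyMeasurable) u hlim
  exact hFatou.trans (liminf_le_of_frequently_le' (Frequently.of_forall hGNS))

/-- **`Ḣ¹ ∩ L^q(ℝ³) ⊂ L⁶(ℝ³)` for weakly differentiable fields, `2 ≤ q < 6`, with the Frobenius
density.** On a `3`-dimensional real inner product space `E`: for `u : E → F'` with a weak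
gradient `G` on the whole space (`HasWeakGradient u G`) and `‖u‖_{L^q} < ∞` for some `2 ≤ q < 6`,
`‖u‖_{L⁶} ≤ K (∫⁻ |G|²_F)^{1/2}` with `|G(x)|²_F = ∑ᵢ ‖G(x) eᵢ‖²` (`frobeniusNormSq`, dominating the
operator norm) and `K = SNormLESNormFDerivOfEqConst F' volume 2` (the case `n = 3`, `p = 2`,
`p' = 6` of `eLpNorm_le_eLpNorm_weakFDeriv_of_eq'`; Evans, *PDE*, §5.6.1; Robinson–Rodrigo–
Sadowski 2016, Thm. 1.7 (i)). [cite: Evans2010, §5.6.1 Thm. 1–2] -/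
theorem eLpNorm_six_le_lintegral_frobeniusNormSq_weakGradient' {F' : Type*}
    [NormedAddCommGroup F'] [InnerProductSpace ℝ F'] [FiniteDimensional ℝ F']
    (hE : finrank ℝ E = 3) {u : E → F'} {G : E → E →L[ℝ] F'} (hw : HasWeakGradient u G)
    {q : ℝ≥0∞} (h2q : 2 ≤ q) (hq6 : q < 6) (huq : eLpNorm u q volume < ∞) :
    eLpNorm u 6 volume ≤ SNormLESNormFDerivOfEqConst F' (volume : Measure E) 2 *
      (∫⁻ x, ENNReal.ofReal (frobeniusNormSq (G x))) ^ (1 / 2 : ℝ) := by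
  have hqt : q ≠ ⊤ := ne_top_of_lt hq6
  have hq' : (3 : ℝ) * (1 / ((2 : ℝ≥0) : ℝ) - 1 / q.toReal) < 1 := by
    have h6 : q.toReal < 6 := by
      simpa using (ENNReal.toReal_lt_toReal hqt (by norm_num)).2 hq6
    have hqpos : 0 < q.toReal := by
      have : (2 : ℝ) ≤ q.toReal := by simpa using ENNReal.toReal_mono hqt h2q
      linarith
    have : 1 / (6 : ℝ) < 1 / q.toReal := one_div_lt_one_div_of_lt hqpos h6
    push_cast
    linarith
  have h := eLpNorm_le_eLpNorm_weakFDeriv_of_eq' hw (p := 2) (p' := 6) (q := q) one_le_two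
    (by exact_mod_cast h2q) (by omega) (by rw [hE]; norm_num) (by rw [hE]; exact hq') huq
  have h' : eLpNorm u 6 volume ≤
      SNormLESNormFDerivOfEqConst F' (volume : Measure E) 2 * eLpNorm G 2 volume := by
    exact_mod_cast h
  refine h'.trans ?_
  gcongr
  -- `‖G‖_{L²} ≤ (∫⁻ |G|²_F)^{1/2}` from `‖G x‖² ≤ |G x|²_F`
  rw [eLpNorm_eq_lintegral_rpow_enorm_toReal two_ne_zero ENNReal.ofNat_ne_top,
    ENNReal.toReal_ofNat]
  gcongr with x
  rw [show (2 : ℝ) = ((2 : ℕ) : ℝ) by norm_num, ENNReal.rpow_natCast, ← ofReal_norm,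
    ← ENNReal.ofReal_pow (norm_nonneg _)]
  exact ENNReal.ofReal_le_ofReal (sq_opNorm_le_frobeniusNormSq _)

/-- **`L^q ∩ Ḣ¹(ℝ³) ⊂ L⁶(ℝ³)` in the vocabulary of the named facts** (`2 ≤ q < 6`): a field
`u ∈ L^q` on a `3`-dimensional space whose extended dissipation `eWeakGradL2Sq u` (the infimum of
`∫⁻ |G|²_F` over the weak gradients `G` of `u`; `⊤` if there is none) is finite lies in `L⁶`
(Evans, *PDE*, §5.6.1, Thm. 2; Robinson–Rodrigo–Sadowski 2016, Thm. 1.7 (i)).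
[cite: Evans2010, §5.6.1 Thm. 1–2] -/
theorem memLp_six_of_memLp_of_eWeakGradL2Sq_lt_top {F' : Type*}
    [NormedAddCommGroup F'] [InnerProductSpace ℝ F'] [FiniteDimensional ℝ F']
    (hE : finrank ℝ E = 3) {u : E → F'} {q : ℝ≥0∞} (h2q : 2 ≤ q) (hq6 : q < 6)
    (huq : MemLp u q volume) (hH1 : eWeakGradL2Sq u < ⊤) : MemLp u 6 volume := by
  obtain ⟨G, hG⟩ := iInf_lt_iff.1 hH1
  obtain ⟨hWG, hGlt⟩ := iInf_lt_iff.1 hG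
  refine ⟨huq.1, lt_of_le_of_lt
    (eLpNorm_six_le_lintegral_frobeniusNormSq_weakGradient' hE hWG h2q hq6 huq.2) ?_⟩
  exact ENNReal.mul_lt_top ENNReal.coe_lt_top
    (ENNReal.rpow_lt_top_of_nonneg (by norm_num) hGlt.ne)

end WeakGNS

/-! ### Lebesgue interpolation in `MemLp` form -/

section Interpolation

/-- **Lebesgue interpolation** `L^a ∩ L^b ⊂ L^r` for `0 < a ≤ r ≤ b < ∞`: if `f ∈ L^a` and
`f ∈ L^b` then `f ∈ L^r` (`∫|f|^r ≤ (∫|f|^a)^{(b−r)/(b−a)} (∫|f|^b)^{(r−a)/(b−a)}`, the tree's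
`lintegral_rpow_interpolate`; Robinson–Rodrigo–Sadowski 2016, Thm. 1.5).
[cite: RobinsonRodrigoSadowski2016, Thm. 1.5] -/
theorem memLp_of_memLp_of_memLp_of_le {α : Type*} [MeasurableSpace α] {μ : Measure α}
    {G : Type*} [NormedAddCommGroup G] {f : α → G} {a b r : ℝ≥0∞} (hfa : MemLp f a μ)
    (hfb : MemLp f b μ) (ha : a ≠ 0) (har : a ≤ r) (hrb : r ≤ b) (hb : b ≠ ⊤) :
    MemLp f r μ := by
  refine ⟨hfa.1, ?_⟩
  have ha0 : 0 < a := pos_iff_ne_zero.2 ha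
  have hr0 : r ≠ 0 := (lt_of_lt_of_le ha0 har).ne'
  have hrt : r ≠ ⊤ := ne_top_of_le_ne_top hb hrb
  have hat : a ≠ ⊤ := ne_top_of_le_ne_top hrt har
  have hb0 : b ≠ 0 := (lt_of_lt_of_le (lt_of_lt_of_le ha0 har) hrb).ne'
  have ha' : 0 < a.toReal := ENNReal.toReal_pos ha hat
  have har' : a.toReal ≤ r.toReal := ENNReal.toReal_mono hrt har
  have hrb' : r.toReal ≤ b.toReal := ENNReal.toReal_mono hb hrb
  have hIa : ∫⁻ x, ‖f x‖ₑ ^ a.toReal ∂μ < ⊤ :=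
    lintegral_rpow_enorm_lt_top_of_eLpNorm_lt_top ha hat hfa.2
  have hIb : ∫⁻ x, ‖f x‖ₑ ^ b.toReal ∂μ < ⊤ :=
    lintegral_rpow_enorm_lt_top_of_eLpNorm_lt_top hb0 hb hfb.2
  rw [eLpNorm_eq_lintegral_rpow_enorm_toReal hr0 hrt]
  refine ENNReal.rpow_lt_top_of_nonneg (by positivity) (lt_top_iff_ne_top.1 ?_)
  rcases eq_or_lt_of_le har' with hEq | hlt
  · rw [← hEq]; exact hIa
  · refine lt_of_le_of_lt (lintegral_rpow_interpolate hfa.1.enorm ha' (lt_of_lt_of_le hlt hrb')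
      har' hrb') (ENNReal.mul_lt_top ?_ ?_)
    · exact ENNReal.rpow_lt_top_of_nonneg
        (div_nonneg (sub_nonneg.2 hrb') (sub_nonneg.2 (har'.trans hrb'))) hIa.ne
    · exact ENNReal.rpow_lt_top_of_nonneg
        (div_nonneg (sub_nonneg.2 har') (sub_nonneg.2 (har'.trans hrb'))) hIb.ne

end Interpolation

/-! ### The very weak steady Liouville theorem on `2 ≤ p ≤ 9/2` and Chae's Thm. 1.4 at `p = 3` -/

section Steady

variable {p : ℝ≥0} {V : EuclideanSpace ℝ (Fin 3) → EuclideanSpace ℝ (Fin 3)}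

/-- **Very weak steady Navier–Stokes solutions in `L^p ∩ Ḣ¹(ℝ³)`, `2 ≤ p ≤ 9/2`, are trivial** —
the last two printed steps of Chae 2010, Thm. 1.4 ("`V̄` is a stationary solution of the
Navier–Stokes equations … In the case `V̄ ∈ Ḣ¹ ∩ L^p` … `∫|∇V̄|² = 0`, which implies `V̄ = 0`")
at the very weak level, now INCLUDING the endpoint `p = 3` (and `2 ≤ p ≤ 3`): the statement of
`veryWeak_steadyNS_ae_eq_zero_of_weakGradL2Sq_lt_top` with its binder `3 < p` replaced by `2 ≤ p`.
Let `V ∈ L^p(ℝ³)`, `2 ≤ p ≤ 9/2`, be weakly divergence free with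
`∫ (⟪V, (V·∇)φ⟫ + ⟪V, Δφ⟫) = 0` for every divergence-free `φ ∈ C_c^∞(ℝ³; ℝ³)` (unit viscosity, no
force) and `eWeakGradL2Sq V < ⊤` (a weak gradient in `L²`). Then `V = 0` a.e. Proof: for
`3 < p` this is the predecessor; for `p ≤ 3`, `V ∈ L⁶` by the weak Gagliardo–Nirenberg–Sobolev
inequality under `L^p` decay (`memLp_six_of_memLp_of_eWeakGradL2Sq_lt_top`), so `V ∈ L⁴` by
Lebesgue interpolation, and the predecessor applies at the exponent `4` (Kato representative +
Galdi's `L^{9/2}` criterion). For `p > 9/2` the last step is the open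
`SteadyDSolutionLiouvilleProblem`; not claimed. [cite: Chae2010, proof of Thm. 1.4 (last two steps; arXiv:0711.1113 §3, proof of Thm. 3.1, p. 8); Galdi2011, Thm. X.9.5; Evans2010, §5.6.1 Thm. 2] -/
theorem veryWeak_steadyNS_ae_eq_zero_of_two_le_of_le_nineHalves (hp2 : 2 ≤ p)
    (hp92 : (p : ℝ≥0∞) ≤ 9 / 2) (hV : MemLp V (p : ℝ≥0∞) volume) (hdiv : IsWeaklyDivFree V)
    (hsteady : ∀ φ : EuclideanSpace ℝ (Fin 3) → EuclideanSpace ℝ (Fin 3),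
      FunctionSpaces.IsTestFunctionOn (⊤ : Opens (EuclideanSpace ℝ (Fin 3))) φ →
      VectorCalculus.IsDivFree φ → ∫ x, (⟪V x, convect V φ x⟫ + ⟪V x, Δ φ x⟫) = 0)
    (hH1 : eWeakGradL2Sq V < ⊤) : V =ᵐ[volume] 0 := by
  rcases lt_or_ge 3 p with hp3 | hp3
  · exact veryWeak_steadyNS_ae_eq_zero_of_weakGradL2Sq_lt_top hp3 hp92 hV hdiv hsteady hH1
  · -- `p ≤ 3`: lift `V` to `L⁶`, interpolate to `L⁴`, and take the `p = 4` road
    have h92top : (9 / 2 : ℝ≥0∞) ≠ ⊤ := by rw [Ne, ENNReal.div_eq_top]; norm_num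
    have hp6 : (p : ℝ≥0∞) < 6 := lt_of_le_of_lt hp92 (by
      rw [ENNReal.div_lt_iff (Or.inl two_ne_zero) (Or.inl ENNReal.ofNat_ne_top)]; norm_num)
    have h2p : (2 : ℝ≥0∞) ≤ (p : ℝ≥0∞) := by exact_mod_cast hp2
    have hV6 : MemLp V 6 volume :=
      memLp_six_of_memLp_of_eWeakGradL2Sq_lt_top finrank_euclideanSpace_fin h2p hp6 hV hH1
    have hp0 : (p : ℝ≥0∞) ≠ 0 := by
      have : (0 : ℝ≥0) < p := lt_of_lt_of_le (by norm_num) hp2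
      exact_mod_cast this.ne'
    have hp4 : (p : ℝ≥0∞) ≤ ((4 : ℝ≥0) : ℝ≥0∞) := by
      have : p ≤ 4 := hp3.trans (by norm_num)
      exact_mod_cast this
    have h46 : ((4 : ℝ≥0) : ℝ≥0∞) ≤ 6 := by norm_num
    have hV4 : MemLp V ((4 : ℝ≥0) : ℝ≥0∞) volume :=
      memLp_of_memLp_of_memLp_of_le hV hV6 hp0 hp4 h46 (by norm_num)
    exact veryWeak_steadyNS_ae_eq_zero_of_weakGradL2Sq_lt_top (p := 4) (by norm_num)
      (by norm_num [ENNReal.le_div_iff_mul_le]) hV4 hdiv hsteady hH1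

end Steady

section Chae

variable {T γ : ℝ} {p : ℝ≥0}
  {v : ℝ → EuclideanSpace ℝ (Fin 3) → EuclideanSpace ℝ (Fin 3)}
  {π : ℝ → EuclideanSpace ℝ (Fin 3) → ℝ}
  {V : EuclideanSpace ℝ (Fin 3) → EuclideanSpace ℝ (Fin 3)}

/-- **Every `L^p` Type-II profile with `2 ≤ p ≤ 9/2` and a weak gradient in `L²` vanishes.**
Let `T > 0`, `(v, π)` a classical solution of Navier–Stokes (`ν = 1`, no force) on
`ℝ³ × (0, T)`, `γ > 1`, `2 ≤ p ≤ 9/2`, and `V̄ ∈ L^p(ℝ³)` with `chaeTypeIIDeviation T γ p v V̄ t → 0`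
as `t ↑ T` (the displayed hypothesis of Chae's Thm. 1.4) and `eWeakGradL2Sq V̄ < ⊤`. Then
`V̄ = 0` a.e.: `V̄` is a very weak steady solution (`typeII_profile_veryWeak_steadyNS`, `2 ≤ p`)
and `veryWeak_steadyNS_ae_eq_zero_of_two_le_of_le_nineHalves` applies. Kato-class continuity of
`v` is not needed; for `p > 9/2` nothing is claimed. [cite: Chae2010, Thm. 1.4 and its proof (= arXiv:0711.1113 Thm. 3.1, p. 8); Galdi2011, Thm. X.9.5] -/
theorem typeII_profile_ae_eq_zero_of_two_le_of_le_nineHalves (hT : 0 < T)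
    (hv : IsClassicalNSSolutionOn (Ioo 0 T) 1 0 v π) (hγ : 1 < γ) (hp2 : 2 ≤ p)
    (hp92 : (p : ℝ≥0∞) ≤ 9 / 2) (hV : MemLp V (p : ℝ≥0∞) volume)
    (hconv : Tendsto (chaeTypeIIDeviation T γ p v V) (𝓝[<] T) (𝓝 0))
    (hH1 : eWeakGradL2Sq V < ⊤) : V =ᵐ[volume] 0 := by
  obtain ⟨hdiv, hsteady⟩ := typeII_profile_veryWeak_steadyNS hT hv hγ hp2 hV hconv
  exact veryWeak_steadyNS_ae_eq_zero_of_two_le_of_le_nineHalves hp2 hp92 hV hdiv hsteady hH1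

/-- **Chae 2010, Theorem 1.4, in the range `3 ≤ p ≤ 9/2` — a theorem (endpoint `p = 3`
included).** The statement of the named fact `chae2010_typeII_asymptoticallySelfSimilar` (J. Funct.
Anal. 258 (2010), Thm. 1.4 = arXiv:0711.1113, Thm. 3.1: "Let `p ∈ [3, ∞)` and
`v ∈ C([0,T); L^p(ℝ³))` be a local classical solution of the Navier–Stokes equations constructed
by Kato. Suppose there exists `γ > 1` and `V̄ ∈ L^p(ℝ³)` such that
`lim_{t→T} (T−t)^{(p−3)γ/(2p)}‖v(·,t) − (T−t)^{−γ/2}V̄(·/(T−t)^{γ/2})‖_{L^p} = 0`. If the blow-up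
profile `V̄` belongs to `Ḣ¹(ℝ³)`, then `V̄ = 0`."), verbatim its binders, with EXACTLY ONE extra
hypothesis `(p : ℝ≥0∞) ≤ 9/2`: then `V̄ = 0` a.e. Proof = the printed one: `V̄` is a very weak
steady solution (`typeII_profile_veryWeak_steadyNS`), hence trivial in `L^p ∩ Ḣ¹`, `p ≤ 9/2`
(`veryWeak_steadyNS_ae_eq_zero_of_two_le_of_le_nineHalves`: weak Sobolev embedding, Kato
representative, Galdi's `L^{9/2}` Liouville criterion). For `p > 9/2` the printed last step is the
open `SteadyDSolutionLiouvilleProblem`; the fact itself is not discharged. [cite: Chae2010, Thm. 1.4 (= arXiv:0711.1113 Thm. 3.1); Galdi2011, Thm. X.9.5] -/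
theorem chae2010_typeII_asymptoticallySelfSimilar_of_le_nineHalves'
    ⦃T : ℝ⦄ (hT : 0 < T) ⦃p : ℝ≥0⦄ (hp : 3 ≤ p) (hp92 : (p : ℝ≥0∞) ≤ 9 / 2)
    ⦃v : ℝ → EuclideanSpace ℝ (Fin 3) → EuclideanSpace ℝ (Fin 3)⦄
    ⦃π : ℝ → EuclideanSpace ℝ (Fin 3) → ℝ⦄
    (hv : IsClassicalNSSolutionOn (Ioo 0 T) 1 0 v π) (_hvc : ContinuousInLpOn (Ico 0 T) p v)
    ⦃γ : ℝ⦄ (hγ : 1 < γ) ⦃V : EuclideanSpace ℝ (Fin 3) → EuclideanSpace ℝ (Fin 3)⦄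
    (hV : MemLp V (p : ℝ≥0∞) volume)
    (hconv : Tendsto (chaeTypeIIDeviation T γ p v V) (𝓝[<] T) (𝓝 0))
    (hH1 : eWeakGradL2Sq V < ⊤) :
    V =ᵐ[volume] 0 :=
  typeII_profile_ae_eq_zero_of_two_le_of_le_nineHalves hT hv hγ (le_trans (by norm_num) hp) hp92
    hV hconv hH1

end Chae

end Literature.Analysis.FluidPDE

end
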